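import Summits.HubbardSuperconductivity.HubbardSuperconductivity.Theorems.JosephsonMirrorWindowDouble

/-!
# Route `JosephsonMirror` — decoupling the two layers of the window double (abstract part)

Helper file for support item stmt-HubbardSuperconductivity-2232 (`JmFreeLayersNoCusp`) of route
`JosephsonMirror` (sub-problem `HubbardSuperconductivity`): the layer-decoupling step of the
`U = 0` calibration, as finite-dimensional linear algebra of the Kronecker double
`H(J) = A ⊗ 1 + 1 ⊗ Aᵀ - J (D ⊗ D̄ + Dᴴ ⊗ D̄ᴴ)` (`D̄ = (Dᴴ)ᵀ`):

* `re_coupling_le` — the operator AM–GM inequality `X Y + Yᴴ Xᴴ ≤ X Xᴴ + Yᴴ Y` for the commuting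
  factors `X = D ⊗ 1`, `Y = 1 ⊗ D̄` (`(Xᴴ - Y)ᴴ (Xᴴ - Y) ≥ 0`), i.e.
  `Re ⟨ψ, (D ⊗ D̄ + Dᴴ ⊗ D̄ᴴ) ψ⟩ ≤ Re ⟨ψ, (D Dᴴ ⊗ 1) ψ⟩ + Re ⟨ψ, (1 ⊗ (Dᴴ D)ᵀ) ψ⟩`, so that
  `H(J) ≥ (A - J D Dᴴ) ⊗ 1 + 1 ⊗ (A - J Dᴴ D)ᵀ` for `J ≥ 0`: each layer sees a reduced BCS
  Hamiltonian and the layers no longer talk to each other;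
* `minEnergyOn_sub_le_of_floors` — if the window `S` consists of the two-layer vectors supported on
  pairs in a common block (`P₁` or `P₂`), the decoupled layer operators `A - J D Dᴴ`, `A - J Dᴴ D`
  are `≥ x`, `≥ y` on vectors supported in a block (column- and row-wise floors), and `A` has a
  unit eigenvector `φ` in `P₁` with eigenvalue `a` (trial state `φ ⊗ φ̄` for `E(0) ≤ 2a`), then
  `E(0) - E(J) ≤ 2a - x - y` (`E(J) = minEnergyOn (H(J)) S`).

Sources: E. H. Lieb, Phys. Rev. Lett. 62 (1989) 1201 (the `W`-matrix packaging); the AM–GM step is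
the planner's route note for this item. No new definitions.
-/

-- the mandated namespace `Summit.<Summit>.<Problem>.Theorems` repeats `HubbardSuperconductivity`
-- (single-problem summit, D-0017), which the `dupNamespace` linter flags on every declaration
set_option linter.dupNamespace false

namespace Summit.HubbardSuperconductivity.HubbardSuperconductivity.Theorems.JosephsonMirror

open Matrix Literature.MathematicalPhysics.QuantumLattice
open scoped Kronecker ComplexOrder

section Abstract

variable {ι : Type*} [Fintype ι] [DecidableEq ι]

/-- `Re ⟨ψ, Mᴴ M ψ⟩ = ‖M ψ‖² ≥ 0`. [folklore] -/
theorem re_star_dotProduct_conjTranspose_mul_self_mulVec_nonneg {m : Type*} [Fintype m]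
    (M : Matrix m m ℂ) (ψ : m → ℂ) : 0 ≤ (star ψ ⬝ᵥ (Mᴴ * M) *ᵥ ψ).re := by
  rw [← mulVec_mulVec, dotProduct_mulVec, ← star_mulVec]
  exact (Complex.nonneg_iff.1 (dotProduct_star_self_nonneg (M *ᵥ ψ))).1

/-- **Operator AM–GM for the Josephson coupling.** With the commuting factors `X = D ⊗ 1` and
`Y = 1 ⊗ D̄` (`D̄ = (Dᴴ)ᵀ`) one has `X Y = D ⊗ D̄`, `Yᴴ Xᴴ = Dᴴ ⊗ D̄ᴴ`, and
`X Xᴴ + Yᴴ Y - (X Y + Yᴴ Xᴴ) = (Xᴴ - Y)ᴴ (Xᴴ - Y) ≥ 0`; as quadratic forms,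
`Re ⟨ψ, (D ⊗ D̄ + Dᴴ ⊗ D̄ᴴ) ψ⟩ ≤ Re ⟨ψ, (D Dᴴ ⊗ 1) ψ⟩ + Re ⟨ψ, (1 ⊗ (Dᴴ D)ᵀ) ψ⟩`. [folklore] -/
theorem re_coupling_le (D : Matrix ι ι ℂ) (ψ : ι × ι → ℂ) :
    (star ψ ⬝ᵥ (D ⊗ₖ Dᴴᵀ + Dᴴ ⊗ₖ Dᵀ) *ᵥ ψ).re ≤
      (star ψ ⬝ᵥ ((D * Dᴴ) ⊗ₖ (1 : Matrix ι ι ℂ)) *ᵥ ψ).re +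
        (star ψ ⬝ᵥ ((1 : Matrix ι ι ℂ) ⊗ₖ (Dᴴ * D)ᵀ) *ᵥ ψ).re := by
  set X : Matrix (ι × ι) (ι × ι) ℂ := D ⊗ₖ (1 : Matrix ι ι ℂ) with hX
  set Y : Matrix (ι × ι) (ι × ι) ℂ := (1 : Matrix ι ι ℂ) ⊗ₖ Dᴴᵀ with hY
  have hYt : Dᴴᵀᴴ = Dᵀ := by
    rw [conjTranspose_transpose_eq_transpose_conjTranspose, conjTranspose_conjTranspose]
  have hM : (Xᴴ - Y)ᴴ * (Xᴴ - Y) =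
      (D * Dᴴ) ⊗ₖ (1 : Matrix ι ι ℂ) + (1 : Matrix ι ι ℂ) ⊗ₖ (Dᴴ * D)ᵀ -
        (D ⊗ₖ Dᴴᵀ + Dᴴ ⊗ₖ Dᵀ) := by
    have h1 : (Xᴴ - Y)ᴴ = X - (1 : Matrix ι ι ℂ) ⊗ₖ Dᵀ := by
      rw [conjTranspose_sub, conjTranspose_conjTranspose, hY, conjTranspose_kronecker,
        conjTranspose_one, hYt]
    have h2 : Xᴴ = Dᴴ ⊗ₖ (1 : Matrix ι ι ℂ) := by
      rw [hX, conjTranspose_kronecker, conjTranspose_one]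
    rw [h1, h2, hX, hY, sub_mul, mul_sub, mul_sub]
    simp only [← mul_kronecker_mul, Matrix.mul_one, Matrix.one_mul, ← transpose_mul]
    abel
  have h0 := re_star_dotProduct_conjTranspose_mul_self_mulVec_nonneg (Xᴴ - Y) ψ
  rw [hM, sub_mulVec, add_mulVec, dotProduct_sub, dotProduct_add, Complex.sub_re,
    Complex.add_re] at h0
  linarith

/-- **Decoupled floors bound the Josephson gain.** Let `A` be Hermitian, `D` arbitrary, and let
the window `S` consist of the two-layer vectors supported on pairs `(s, t)` lying in a common
block (`P₁` or `P₂`, disjoint). Suppose the decoupled layer operators are bounded below on the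
vectors supported in a single block: `A - J D Dᴴ ≥ x` and `A - J Dᴴ D ≥ y` there, and that `A`
has a unit eigenvector `φ` supported in `P₁` with eigenvalue `a`. Then for `J ≥ 0` the lowest
energy `E(J)` of `H(J) = A ⊗ 1 + 1 ⊗ Aᵀ - J (D ⊗ D̄ + Dᴴ ⊗ D̄ᴴ)` on `S` satisfies
`E(0) - E(J) ≤ 2a - x - y`: `E(0) ≤ 2a` by the trial state `φ ⊗ φ̄`, and
`E(J) ≥ x + y` by the operator AM–GM inequality (`re_coupling_le`) and the column/row
decomposition of `⟨ψ, (X ⊗ 1) ψ⟩`, `⟨ψ, (1 ⊗ Yᵀ) ψ⟩`. Lieb, PRL 62 (1989) 1201 (packaging).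
[folklore] -/
theorem minEnergyOn_sub_le_of_floors (A D : Matrix ι ι ℂ) (hA : A.IsHermitian)
    (P₁ P₂ : ι → Prop) (h12 : ∀ s, P₁ s → ¬ P₂ s)
    (good : ι × ι → Prop) (hgood : ∀ s t, good (s, t) → (P₁ s ∧ P₁ t) ∨ (P₂ s ∧ P₂ t))
    (hgood₁ : ∀ s t, P₁ s → P₁ t → good (s, t))
    (S : Submodule ℂ (ι × ι → ℂ)) (hS : ∀ ψ, ψ ∈ S ↔ ∀ p, ¬ good p → ψ p = 0)
    (a x y : ℝ) {J : ℝ}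
    (hX : ∀ v : ι → ℂ, ((∀ s, ¬ P₁ s → v s = 0) ∨ (∀ s, ¬ P₂ s → v s = 0)) →
      x * (star v ⬝ᵥ v).re ≤ (star v ⬝ᵥ (A - (J : ℂ) • (D * Dᴴ)) *ᵥ v).re)
    (hY : ∀ v : ι → ℂ, ((∀ s, ¬ P₁ s → v s = 0) ∨ (∀ s, ¬ P₂ s → v s = 0)) →
      y * (star v ⬝ᵥ v).re ≤ (star v ⬝ᵥ (A - (J : ℂ) • (Dᴴ * D)) *ᵥ v).re)
    (φ : ι → ℂ) (hφP : ∀ s, ¬ P₁ s → φ s = 0) (hφ1 : star φ ⬝ᵥ φ = 1)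
    (hAφ : A *ᵥ φ = (a : ℂ) • φ) (hJ : 0 ≤ J) :
    (A ⊗ₖ (1 : Matrix ι ι ℂ) + (1 : Matrix ι ι ℂ) ⊗ₖ Aᵀ -
          ((0 : ℝ) : ℂ) • (D ⊗ₖ Dᴴᵀ + Dᴴ ⊗ₖ Dᵀ)).minEnergyOn S -
        (A ⊗ₖ (1 : Matrix ι ι ℂ) + (1 : Matrix ι ι ℂ) ⊗ₖ Aᵀ -
          (J : ℂ) • (D ⊗ₖ Dᴴᵀ + Dᴴ ⊗ₖ Dᵀ)).minEnergyOn S ≤ 2 * a - x - y := by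
  -- notation
  set H₀ : Matrix (ι × ι) (ι × ι) ℂ := A ⊗ₖ (1 : Matrix ι ι ℂ) + (1 : Matrix ι ι ℂ) ⊗ₖ Aᵀ with hH₀
  set K : Matrix (ι × ι) (ι × ι) ℂ := D ⊗ₖ Dᴴᵀ + Dᴴ ⊗ₖ Dᵀ with hK
  -- supports of columns and rows of window vectors
  have hcol : ∀ ψ ∈ S, ∀ t, (∀ s, ¬ P₁ s → ψ (s, t) = 0) ∨ (∀ s, ¬ P₂ s → ψ (s, t) = 0) := by
    intro ψ hψ t
    have hz : ∀ s, ¬ good (s, t) → ψ (s, t) = 0 := fun s hs => (hS ψ).1 hψ (s, t) hs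
    by_cases h1 : P₁ t
    · refine Or.inl fun s hs => hz s fun hg => ?_
      rcases hgood s t hg with ⟨hs', -⟩ | ⟨-, ht'⟩
      · exact hs hs'
      · exact h12 t h1 ht'
    · by_cases h2 : P₂ t
      · refine Or.inr fun s hs => hz s fun hg => ?_
        rcases hgood s t hg with ⟨-, ht'⟩ | ⟨hs', -⟩
        · exact h1 ht'
        · exact hs hs'
      · refine Or.inl fun s _ => hz s fun hg => ?_
        rcases hgood s t hg with ⟨-, ht'⟩ | ⟨-, ht'⟩
        · exact h1 ht'
        · exact h2 ht'
  have hrow : ∀ ψ ∈ S, ∀ s, (∀ t, ¬ P₁ t → ψ (s, t) = 0) ∨ (∀ t, ¬ P₂ t → ψ (s, t) = 0) := by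
    intro ψ hψ s
    have hz : ∀ t, ¬ good (s, t) → ψ (s, t) = 0 := fun t ht => (hS ψ).1 hψ (s, t) ht
    by_cases h1 : P₁ s
    · refine Or.inl fun t ht => hz t fun hg => ?_
      rcases hgood s t hg with ⟨-, ht'⟩ | ⟨hs', -⟩
      · exact ht ht'
      · exact h12 s h1 hs'
    · by_cases h2 : P₂ s
      · refine Or.inr fun t ht => hz t fun hg => ?_
        rcases hgood s t hg with ⟨hs', -⟩ | ⟨-, ht'⟩
        · exact h1 hs'
        · exact ht ht'
      · refine Or.inl fun t _ => hz t fun hg => ?_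
        rcases hgood s t hg with ⟨hs', -⟩ | ⟨hs', -⟩
        · exact h1 hs'
        · exact h2 hs'
  -- (1) lower bound `(x + y) ‖ψ‖² ≤ Re ⟨ψ, H(J) ψ⟩` on the window
  have hlow : ∀ ψ ∈ S, (x + y) * (star ψ ⬝ᵥ ψ).re ≤ (star ψ ⬝ᵥ (H₀ - (J : ℂ) • K) *ᵥ ψ).re := by
    intro ψ hψ
    -- columns: `x ‖ψ‖² ≤ Re ⟨ψ, ((A - J D Dᴴ) ⊗ 1) ψ⟩`
    have hc : x * (star ψ ⬝ᵥ ψ).re ≤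
        (star ψ ⬝ᵥ (A ⊗ₖ (1 : Matrix ι ι ℂ)) *ᵥ ψ).re -
          J * (star ψ ⬝ᵥ ((D * Dᴴ) ⊗ₖ (1 : Matrix ι ι ℂ)) *ᵥ ψ).re := by
      rw [star_dotProduct_kronecker_one_mulVec, star_dotProduct_kronecker_one_mulVec,
        star_dotProduct_self_eq_sum_cols, Complex.re_sum, Complex.re_sum, Complex.re_sum,
        Finset.mul_sum, Finset.mul_sum, ← Finset.sum_sub_distrib]
      refine Finset.sum_le_sum fun t _ => ?_
      have h := hX (fun s => ψ (s, t)) (hcol ψ hψ t)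
      rw [sub_mulVec, smul_mulVec, dotProduct_sub, dotProduct_smul, smul_eq_mul, Complex.sub_re,
        Complex.re_ofReal_mul] at h
      exact h
    -- rows: `y ‖ψ‖² ≤ Re ⟨ψ, (1 ⊗ (A - J Dᴴ D)ᵀ) ψ⟩`
    have hr : y * (star ψ ⬝ᵥ ψ).re ≤
        (star ψ ⬝ᵥ ((1 : Matrix ι ι ℂ) ⊗ₖ Aᵀ) *ᵥ ψ).re -
          J * (star ψ ⬝ᵥ ((1 : Matrix ι ι ℂ) ⊗ₖ (Dᴴ * D)ᵀ) *ᵥ ψ).re := by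
      rw [star_dotProduct_one_kronecker_mulVec, star_dotProduct_one_kronecker_mulVec,
        star_dotProduct_self_eq_sum_rows, Complex.re_sum, Complex.re_sum, Complex.re_sum,
        Finset.mul_sum, Finset.mul_sum, ← Finset.sum_sub_distrib]
      refine Finset.sum_le_sum fun s _ => ?_
      rw [star_dotProduct_transpose_mulVec, star_dotProduct_transpose_mulVec,
        ← star_star_dotProduct_star_self]
      have hsupp : (∀ t, ¬ P₁ t → (star fun t => ψ (s, t)) t = 0) ∨
          (∀ t, ¬ P₂ t → (star fun t => ψ (s, t)) t = 0) := by
        rcases hrow ψ hψ s with h | h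
        · exact Or.inl fun t ht => by simp [h t ht]
        · exact Or.inr fun t ht => by simp [h t ht]
      have h := hY (star fun t => ψ (s, t)) hsupp
      rw [sub_mulVec, smul_mulVec, dotProduct_sub, dotProduct_smul, smul_eq_mul, Complex.sub_re,
        Complex.re_ofReal_mul] at h
      exact h
    have hKψ := re_coupling_le D ψ
    rw [sub_mulVec, smul_mulVec, dotProduct_sub, dotProduct_smul, smul_eq_mul, Complex.sub_re,
      Complex.re_ofReal_mul, hH₀, add_mulVec, dotProduct_add, Complex.add_re]
    have hJK : J * (star ψ ⬝ᵥ K *ᵥ ψ).re ≤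
        J * (star ψ ⬝ᵥ ((D * Dᴴ) ⊗ₖ (1 : Matrix ι ι ℂ)) *ᵥ ψ).re +
          J * (star ψ ⬝ᵥ ((1 : Matrix ι ι ℂ) ⊗ₖ (Dᴴ * D)ᵀ) *ᵥ ψ).re := by
      rw [← mul_add]
      exact mul_le_mul_of_nonneg_left hKψ hJ
    linarith
  -- (2) the trial vector `φ ⊗ φ̄`
  set v : ι × ι → ℂ := fun p : ι × ι => φ p.1 * (star φ) p.2 with hv
  have hvv : star v ⬝ᵥ v = 1 := by
    rw [hv, star_tensor_conj_dotProduct, hφ1]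
    simp
  have hvS : v ∈ S := by
    refine (hS v).2 fun p hp => ?_
    obtain ⟨s, t⟩ := p
    show φ s * (star φ) t = 0
    by_cases hs : P₁ s
    · by_cases ht : P₁ t
      · exact absurd (hgood₁ s t hs ht) hp
      · rw [Pi.star_apply, hφP t ht, star_zero, mul_zero]
    · rw [hφP s hs, zero_mul]
  have hH₀v : H₀ *ᵥ v = ((2 * a : ℝ) : ℂ) • v := by
    rw [hH₀, hv, double_mulVec_tensor_conj hA hAφ]
  -- (3) upper bound on `E(0)` by the trial state
  have hup : (H₀ - ((0 : ℝ) : ℂ) • K).minEnergyOn S ≤ 2 * a := by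
    rw [Complex.ofReal_zero, zero_smul, sub_zero]
    refine (minEnergyOn_le_rayleigh_of_mem (isHermitian_double hA) S hvS hvv).trans (le_of_eq ?_)
    rw [hH₀v, dotProduct_smul, hvv, smul_eq_mul, mul_one, Complex.ofReal_re]
  -- (4) lower bound on `E(J)`
  have hlowJ : x + y ≤ (H₀ - (J : ℂ) • K).minEnergyOn S := by
    refine le_csInf ⟨(star v ⬝ᵥ (H₀ - (J : ℂ) • K) *ᵥ v).re, v, hvS, hvv, rfl⟩ ?_
    rintro E ⟨ψ, hψS, hψ1, rfl⟩
    have h := hlow ψ hψS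
    rw [hψ1, Complex.one_re, mul_one] at h
    exact h
  linarith

end Abstract

end Summit.HubbardSuperconductivity.HubbardSuperconductivity.Theorems.JosephsonMirror
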